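import Summits.BirchSwinnertonDyer.BirchSwinnertonDyer.Theorems.ManinLocalTwoThreePinningKernelStaged
import Summits.BirchSwinnertonDyer.BirchSwinnertonDyer.Theorems.ManinLocalTwoThreePinningKernelCusp
import Summits.BirchSwinnertonDyer.BirchSwinnertonDyer.Theorems.ManinLocalTwoThreePinningOneSeventyOneTables
import Literature.NumberTheory.EllipticCurves.ModularFormsGamma0WeightTwoDimension
import HarnessLib

/-!
# LEVEL 171 (genus 17) by the PINNING KERNEL IN `S₂` WITH A HECKE/TWIST-CLOSURE BASIS: THE NEWFORM OF EVERY `X₀(171)`-DATUM, FACT-FREE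

Cell `bsd-f2-manin`, route `ManinLocalTwoThree`, crux C3 `ManinPrimeToThreeAtNine` (stmt-BirchSwinnertonDyer-22968, `9 ∣ 171`), an g58
(LENS analytic/periods); `--supports stmt-BirchSwinnertonDyer-22967` (helper, the route's pinning series).  INSTANCE of
`…PinningKernel{Sieve,,Staged,Cusp,Hecke}`: part B's abstract kernel `exists_smul_eq_sum_of_certs` run in `V = S₂(Γ₀(171))`
(`coef = cuspCoeffₗ`, `dim = g = 17`) on the basis of part 1 (`…PinningOneSeventyOneTables`): the 3 cuspidal `η`-quotient seeds
`h0 … h2` closed under `χ· = (·/3)`-twist, `T₂`, `U₃` — `h0, h1, h2, χ·h0, χ·h2, χ·χ·h0, χ·χ·h2, T₂ h0, T₂ h2, χ·T₂ h0, χ·χ·T₂ h0, U₃ h0, U₃ h2, χ·U₃ h0, χ·U₃ h2, χ·χ·U₃ h0, χ·χ·U₃ h2` (`basis`).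
WHY A NEW BASIS: the cuspidal `η`-quotients of level 171 are 3 in number (`g = 17`), the holomorphic ones do not span `M₂` either, and the
levels `171/3, 171/9` carry no weight-2 `η`-quotients at all — the `η`-kernel of the levels `120 … 400` has no pool here; the Hecke/twist
closure of the seeds has full rank 17 already at depth 48 (an g58 `heckeclose.py`).
THE RESULT.  The seed tables are certified to depth 192 (sparse `η` certificates), the 17 basis tables to depth 64 follow by part H
(`table_heckeT`, `table_twist3`, `table_mono`) from decidable list identities, the integer duals have `d = 2160`; the staged box sieve over
`3, 2, 5, 7, 11, 13` (`a₃ = 0` forced by `9 ∣ 171`) with the certified column relations leaves exactly 8 prime assignments (`certs`):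
the 4 rational newform classes `171a`, `171b`, `171c`, `171d` and the `3`-depleted coefficient systems of the old classes
`57a`, `57c`, `19a`, `57b` (consistent with every linear relation of `S₂(Γ₀(171))`, realised by no datum since `a₃(D.f) = 0 ≠ a₃`
of those classes; harmless: a consumer reads its class off `truth W`).  **`pinning_cusp (D)`**: for every `X₀(171)`-datum `D` of an elliptic `W/ℚ`
there are the seed cusp forms `S` (values = the `η`-quotients of `Ls`) and a certificate `(σ, d′, y) ∈ certs` with `truth W = σ` and
`d′ • D.f = Σ_j y_j • basis S j` in `S₂(Γ₀(171))`; here every `d′ = 1`.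
HONEST FRAMING: unconditional, standard axioms; no newness/eigen statement about the basis is claimed; the Néron/`c`-side at `171` is NOT
touched (the roots `19a`, `57a–c` of the twist census are not `η`-products); nothing here proves C2/C3, Manin's conjecture or BSD.
[cite: CremonaAlgorithms1997, §2.10, Table 1 (171a, 171b, 171c, 171d)] [cite: AtkinLehner1970, Thm. 3] [cite: DiamondShurman2005, Thm. 3.5.1, Prop. 5.2.2(a)]
[cite: Shimura1971, Prop. 3.64] [cite: Koehler2011, §2.1] [cite: Ligozat1975, Ch. 3]
-/

set_option autoImplicit false
-- lint-debt: the directory name repeats the summit name (sibling precedent `ManinLocalTwoThreePinningSixtyThree.lean`)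
set_option linter.dupNamespace false

noncomputable section


open Complex
open UpperHalfPlane hiding I
open scoped MatrixGroups ModularForm
open ModularForm CongruenceSubgroup
open Literature.NumberTheory.ModularForms
open Literature.NumberTheory.EllipticCurves Literature.NumberTheory.EllipticCurves.ModularForms

namespace Summit.BirchSwinnertonDyer.BirchSwinnertonDyer.Theorems.ManinLocalTwoThree.PinningOneSeventyOne

open Summit.BirchSwinnertonDyer.BirchSwinnertonDyer.Theorems.ManinLocalTwoThree.BracketSturm
open Summit.BirchSwinnertonDyer.BirchSwinnertonDyer.Theorems.ManinLocalTwoThree.PinningKernel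


set_option maxHeartbeats 4000000
set_option maxRecDepth 16384

/-! ## §3 Duals, relations, the staged sieve -/

/-- **The dual certificate** `⟨dualsᵢ, tabsⱼ⟩ = 2160·δᵢⱼ`. [folklore] -/
theorem hdual : ∀ i j : Fin 17, dotList (duals i) (tabs j) = if i = j then (2160 : ℤ) else 0 := by
  decide +kernel

/-- Sieve stage `0`: the live list `L_0` is mapped into `L_1` (kernel `decide`). [folklore] -/
theorem hst0 : ∀ σ ∈ sieveStep 171 64 ((([[]] : List (List (ℕ × ℤ))) :: lvs).getD 0 []) (stages.getD 0 (0, [])), σ ∈ lvs.getD 0 [] := by decide +kernel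
/-- Sieve stage `1`: the live list `L_1` is mapped into `L_2` (kernel `decide`). [folklore] -/
theorem hst1 : ∀ σ ∈ sieveStep 171 64 ((([[]] : List (List (ℕ × ℤ))) :: lvs).getD 1 []) (stages.getD 1 (0, [])), σ ∈ lvs.getD 1 [] := by decide +kernel
/-- Sieve stage `2`: the live list `L_2` is mapped into `L_3` (kernel `decide`). [folklore] -/
theorem hst2 : ∀ σ ∈ sieveStep 171 64 ((([[]] : List (List (ℕ × ℤ))) :: lvs).getD 2 []) (stages.getD 2 (0, [])), σ ∈ lvs.getD 2 [] := by decide +kernel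
/-- Stage 3 (`p = 7`, 45 live × box 11) is certified in 8 chunks. [folklore] -/
def chunks3 : List (List (List (ℕ × ℤ))) :=
  [[[(3, 0), (2, -2), (5, -4)], [(3, 0), (2, -2), (5, -3)], [(3, 0), (2, -2), (5, -2)], [(3, 0), (2, -2), (5, -1)], [(3, 0), (2, -2), (5, 0)], [(3, 0), (2, -2), (5, 1)]],
   [[(3, 0), (2, -2), (5, 2)], [(3, 0), (2, -2), (5, 3)], [(3, 0), (2, -2), (5, 4)], [(3, 0), (2, -1), (5, -4)], [(3, 0), (2, -1), (5, -3)], [(3, 0), (2, -1), (5, -2)]],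
   [[(3, 0), (2, -1), (5, -1)], [(3, 0), (2, -1), (5, 0)], [(3, 0), (2, -1), (5, 1)], [(3, 0), (2, -1), (5, 2)], [(3, 0), (2, -1), (5, 3)], [(3, 0), (2, -1), (5, 4)]],
   [[(3, 0), (2, 0), (5, -4)], [(3, 0), (2, 0), (5, -3)], [(3, 0), (2, 0), (5, -2)], [(3, 0), (2, 0), (5, -1)], [(3, 0), (2, 0), (5, 0)], [(3, 0), (2, 0), (5, 1)]],
   [[(3, 0), (2, 0), (5, 2)], [(3, 0), (2, 0), (5, 3)], [(3, 0), (2, 0), (5, 4)], [(3, 0), (2, 1), (5, -4)], [(3, 0), (2, 1), (5, -3)], [(3, 0), (2, 1), (5, -2)]],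
   [[(3, 0), (2, 1), (5, -1)], [(3, 0), (2, 1), (5, 0)], [(3, 0), (2, 1), (5, 1)], [(3, 0), (2, 1), (5, 2)], [(3, 0), (2, 1), (5, 3)], [(3, 0), (2, 1), (5, 4)]],
   [[(3, 0), (2, 2), (5, -4)], [(3, 0), (2, 2), (5, -3)], [(3, 0), (2, 2), (5, -2)], [(3, 0), (2, 2), (5, -1)], [(3, 0), (2, 2), (5, 0)], [(3, 0), (2, 2), (5, 1)]],
   [[(3, 0), (2, 2), (5, 2)], [(3, 0), (2, 2), (5, 3)], [(3, 0), (2, 2), (5, 4)]]]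
/-- Sieve stage `3`, chunk `0` (kernel `decide`). [folklore] -/
theorem hst3c0 : ∀ σ ∈ sieveStep 171 64 (chunks3.getD 0 []) (stages.getD 3 (0, [])), σ ∈ lvs.getD 3 [] := by decide +kernel
/-- Sieve stage `3`, chunk `1` (kernel `decide`). [folklore] -/
theorem hst3c1 : ∀ σ ∈ sieveStep 171 64 (chunks3.getD 1 []) (stages.getD 3 (0, [])), σ ∈ lvs.getD 3 [] := by decide +kernel
/-- Sieve stage `3`, chunk `2` (kernel `decide`). [folklore] -/
theorem hst3c2 : ∀ σ ∈ sieveStep 171 64 (chunks3.getD 2 []) (stages.getD 3 (0, [])), σ ∈ lvs.getD 3 [] := by decide +kernel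
/-- Sieve stage `3`, chunk `3` (kernel `decide`). [folklore] -/
theorem hst3c3 : ∀ σ ∈ sieveStep 171 64 (chunks3.getD 3 []) (stages.getD 3 (0, [])), σ ∈ lvs.getD 3 [] := by decide +kernel
/-- Sieve stage `3`, chunk `4` (kernel `decide`). [folklore] -/
theorem hst3c4 : ∀ σ ∈ sieveStep 171 64 (chunks3.getD 4 []) (stages.getD 3 (0, [])), σ ∈ lvs.getD 3 [] := by decide +kernel
/-- Sieve stage `3`, chunk `5` (kernel `decide`). [folklore] -/
theorem hst3c5 : ∀ σ ∈ sieveStep 171 64 (chunks3.getD 5 []) (stages.getD 3 (0, [])), σ ∈ lvs.getD 3 [] := by decide +kernel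
/-- Sieve stage `3`, chunk `6` (kernel `decide`). [folklore] -/
theorem hst3c6 : ∀ σ ∈ sieveStep 171 64 (chunks3.getD 6 []) (stages.getD 3 (0, [])), σ ∈ lvs.getD 3 [] := by decide +kernel
/-- Sieve stage `3`, chunk `7` (kernel `decide`). [folklore] -/
theorem hst3c7 : ∀ σ ∈ sieveStep 171 64 (chunks3.getD 7 []) (stages.getD 3 (0, [])), σ ∈ lvs.getD 3 [] := by decide +kernel
/-- Sieve stage `3`: the live list `L_3` is mapped into `L_4` (kernel `decide`). [folklore] -/
theorem hst3 : ∀ σ ∈ sieveStep 171 64 ((([[]] : List (List (ℕ × ℤ))) :: lvs).getD 3 []) (stages.getD 3 (0, [])), σ ∈ lvs.getD 3 [] :=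
  sieveStep_subset_of_chunks 171 64 chunks3 (by decide +kernel) fun j hj ↦ by
    have hj' : j < 8 := lt_of_lt_of_eq hj (by decide)
    interval_cases j
    exacts [hst3c0, hst3c1, hst3c2, hst3c3, hst3c4, hst3c5, hst3c6, hst3c7]
/-- Sieve stage `4`: the live list `L_4` is mapped into `L_5` (kernel `decide`). [folklore] -/
theorem hst4 : ∀ σ ∈ sieveStep 171 64 ((([[]] : List (List (ℕ × ℤ))) :: lvs).getD 4 []) (stages.getD 4 (0, [])), σ ∈ lvs.getD 4 [] := by decide +kernel
/-- Sieve stage `5`: the live list `L_5` is mapped into `L_6` (kernel `decide`). [folklore] -/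
theorem hst5 : ∀ σ ∈ sieveStep 171 64 ((([[]] : List (List (ℕ × ℤ))) :: lvs).getD 5 []) (stages.getD 5 (0, [])), σ ∈ lvs.getD 5 [] := by decide +kernel

/-- **THE SIEVE**, certified one stage at a time (`hst0 … hst5`), assembled by `PinningKernel.runSieve_subset_of_chain`
(part D `…PinningKernelStaged`): the staged box sieve returns only assignments listed in `certs`. [cite: CremonaAlgorithms1997, §2.10] -/
theorem hcover : ∀ σ ∈ runSieve 171 64 stages, σ ∈ certs.map Prod.fst := by
  have hch : ∀ k < stages.length, ∀ σ ∈ sieveStep 171 64 ((([[]] : List (List (ℕ × ℤ))) :: lvs).getD k [])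
      (stages.getD k (0, [])), σ ∈ lvs.getD k [] := by
    intro k hk
    have hk' : k < 6 := lt_of_lt_of_eq hk (by decide)
    interval_cases k
    exacts [hst0, hst1, hst2, hst3, hst4, hst5]
  have hlast : ((([[]] : List (List (ℕ × ℤ))) :: lvs).getD stages.length []) = certs.map Prod.fst := by decide +kernel
  exact fun σ hσ ↦ hlast ▸ runSieve_subset_of_chain 171 64 stages lvs (by decide) hch σ hσ

/-- **The coordinate certificates** `d'·aₙ(σ) = Σ_j y_j·tabsⱼ[n]` on the dual support. [folklore] -/
theorem hpiv : ∀ c ∈ certs, ∀ i : Fin 17, ∀ n < (duals i).length, (duals i).getD n 0 ≠ 0 →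
    (evalOpt 171 c.1 n).map (fun x ↦ c.2.1 * x) = some (∑ j : Fin 17, c.2.2.getD (j : ℕ) 0 * (tabs j).getD n 0) := by
  decide +kernel

/-! ## §4 `dim S₂(Γ₀(171)) = 17` -/

/-- `μ(Γ₀(171)) = 240`, `ν_∞ = 8`, `ν₂ = ν₃ = 0`. [cite: DiamondShurman2005, §3.8] -/
theorem gamma0_data : gamma0Index 171 = 240 ∧ nuInfty 171 = 8 ∧ nu₂ 171 = 0 ∧ nu₃ 171 = 0 := by
  refine ⟨?_, by decide, by rw [nu₂_eq_card]; decide, by rw [nu₃_eq_card]; decide⟩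
  · rw [(gamma0Index_mul (m := 9) (n := 19) (by norm_num)),
      show (9 : ℕ) = 3 ^ 2 by norm_num, gamma0Index_prime_pow (p := 3) (e := 2) Nat.prime_three (by norm_num),
      gamma0Index_prime (by norm_num : Nat.Prime 19)]
    norm_num

/-- **`dim S₂(Γ₀(171)) = 17`** (the genus; `μ = 240`, `ν_∞ = 8`), by the tree's `finrank_cuspForm_two_eq_genusX0_holds`.
[cite: DiamondShurman2005, Thm. 3.5.1] -/
theorem finrank_cuspForm_two : Module.finrank ℂ (CuspForm (Gamma0 171) 2) = 17 := by
  obtain ⟨h1, h2, h3, h4⟩ := gamma0_data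
  have h : Module.finrank ℂ (CuspForm (Gamma0 171) 2) = genusX0 171 := finrank_cuspForm_two_eq_genusX0_holds 171
  rw [h, genusX0, h1, h2, h3, h4]

/-! ## §5 The basis: the seeds closed under `(·/3)`-twist, `T₂`, `U₃`; its certified tables -/

/-- The `(·/3)`-twist on `S₂(Γ₀(171))` (`9 ∣ 171`; tree `charTwist`, same level). [cite: Shimura1971, Prop. 3.64] -/
def X (f : CuspForm (Gamma0 171) 2) : CuspForm (Gamma0 171) 2 :=
  charTwist 171 dvd_rfl (by norm_num : 3 ^ 2 ∣ 171) (isQuadratic_quadraticChar_ringHomComp 3) f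

/-- `T₂` on `S₂(Γ₀(171))` (tree `heckeT`). [cite: DiamondShurman2005, Prop. 5.2.2(a)] -/
def T2 (f : CuspForm (Gamma0 171) 2) : CuspForm (Gamma0 171) 2 := heckeT (Gamma0 171) 2 2 f

/-- `U₃` on `S₂(Γ₀(171))` (tree `heckeT` at `p = 3 ∣ 171`). [cite: DiamondShurman2005, Prop. 5.2.2(a)] -/
def U3 (f : CuspForm (Gamma0 171) 2) : CuspForm (Gamma0 171) 2 := heckeT (Gamma0 171) 2 3 f

/-- **The basis** as words in `χ·, T₂, U₃` applied to the seeds `S 0 … S 2`: `h0, h1, h2, χ·h0, χ·h2, χ·χ·h0, χ·χ·h2, T₂ h0, T₂ h2, χ·T₂ h0, χ·χ·T₂ h0, U₃ h0, U₃ h2, χ·U₃ h0, χ·U₃ h2, χ·χ·U₃ h0, χ·χ·U₃ h2`. [folklore] -/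
def basis (S : Fin 3 → CuspForm (Gamma0 171) 2) : Fin 17 → CuspForm (Gamma0 171) 2 :=
  ![S 0, S 1, S 2, X (S 0), X (S 2), X (X (S 0)), X (X (S 2)), T2 (S 0), T2 (S 2), X (T2 (S 0)), X (X (T2 (S 0))), U3 (S 0), U3 (S 2), X (U3 (S 0)), X (U3 (S 2)), X (X (U3 (S 0))), X (X (U3 (S 2)))]

section Tables

variable (S : Fin 3 → CuspForm (Gamma0 171) 2) (hs : ∀ i, ∀ m < 192, (((stabs i).getD m 0 : ℤ) : ℂ) = cuspCoeff (S i) m)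
include hs

/-- Certified table of basis form `0` = `h0`. [folklore] -/
theorem hb0 : ∀ n < 64, (((tabs 0).getD n 0 : ℤ) : ℂ) = cuspCoeff (S 0) n :=
  table_mono (fun n (F : CuspForm (Gamma0 171) 2) ↦ cuspCoeff F n) (by norm_num : 64 ≤ 192) (S 0) (stabs 0) (tabs 0) (hs 0) hder0
/-- Certified table of basis form `1` = `h1`. [folklore] -/
theorem hb1 : ∀ n < 64, (((tabs 1).getD n 0 : ℤ) : ℂ) = cuspCoeff (S 1) n :=
  table_mono (fun n (F : CuspForm (Gamma0 171) 2) ↦ cuspCoeff F n) (by norm_num : 64 ≤ 192) (S 1) (stabs 1) (tabs 1) (hs 1) hder1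
/-- Certified table of basis form `2` = `h2`. [folklore] -/
theorem hb2 : ∀ n < 64, (((tabs 2).getD n 0 : ℤ) : ℂ) = cuspCoeff (S 2) n :=
  table_mono (fun n (F : CuspForm (Gamma0 171) 2) ↦ cuspCoeff F n) (by norm_num : 64 ≤ 192) (S 2) (stabs 2) (tabs 2) (hs 2) hder2
/-- Certified table of basis form `3` = `χ·h0`. [folklore] -/
theorem hb3 : ∀ n < 64, (((tabs 3).getD n 0 : ℤ) : ℂ) = cuspCoeff (X (S 0)) n :=
  table_twist3 (by norm_num : 3 ^ 2 ∣ 171) 64 (S 0) (tabs 0) (tabs 3) (hb0 S hs) hder3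
/-- Certified table of basis form `4` = `χ·h2`. [folklore] -/
theorem hb4 : ∀ n < 64, (((tabs 4).getD n 0 : ℤ) : ℂ) = cuspCoeff (X (S 2)) n :=
  table_twist3 (by norm_num : 3 ^ 2 ∣ 171) 64 (S 2) (tabs 2) (tabs 4) (hb2 S hs) hder4
/-- Certified table of basis form `5` = `χ·χ·h0`. [folklore] -/
theorem hb5 : ∀ n < 64, (((tabs 5).getD n 0 : ℤ) : ℂ) = cuspCoeff (X (X (S 0))) n :=
  table_twist3 (by norm_num : 3 ^ 2 ∣ 171) 64 (X (S 0)) (tabs 3) (tabs 5) (hb3 S hs) hder5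
/-- Certified table of basis form `6` = `χ·χ·h2`. [folklore] -/
theorem hb6 : ∀ n < 64, (((tabs 6).getD n 0 : ℤ) : ℂ) = cuspCoeff (X (X (S 2))) n :=
  table_twist3 (by norm_num : 3 ^ 2 ∣ 171) 64 (X (S 2)) (tabs 4) (tabs 6) (hb4 S hs) hder6
/-- Certified table of basis form `7` = `T₂ h0`. [folklore] -/
theorem hb7 : ∀ n < 64, (((tabs 7).getD n 0 : ℤ) : ℂ) = cuspCoeff (T2 (S 0)) n :=
  table_heckeT Nat.prime_two 64 (S 0) (stabs 0) (tabs 7) (fun m hm ↦ hs 0 m (by omega)) hder7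
/-- Certified table of basis form `8` = `T₂ h2`. [folklore] -/
theorem hb8 : ∀ n < 64, (((tabs 8).getD n 0 : ℤ) : ℂ) = cuspCoeff (T2 (S 2)) n :=
  table_heckeT Nat.prime_two 64 (S 2) (stabs 2) (tabs 8) (fun m hm ↦ hs 2 m (by omega)) hder8
/-- Certified table of basis form `9` = `χ·T₂ h0`. [folklore] -/
theorem hb9 : ∀ n < 64, (((tabs 9).getD n 0 : ℤ) : ℂ) = cuspCoeff (X (T2 (S 0))) n :=
  table_twist3 (by norm_num : 3 ^ 2 ∣ 171) 64 (T2 (S 0)) (tabs 7) (tabs 9) (hb7 S hs) hder9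
/-- Certified table of basis form `10` = `χ·χ·T₂ h0`. [folklore] -/
theorem hb10 : ∀ n < 64, (((tabs 10).getD n 0 : ℤ) : ℂ) = cuspCoeff (X (X (T2 (S 0)))) n :=
  table_twist3 (by norm_num : 3 ^ 2 ∣ 171) 64 (X (T2 (S 0))) (tabs 9) (tabs 10) (hb9 S hs) hder10
/-- Certified table of basis form `11` = `U₃ h0`. [folklore] -/
theorem hb11 : ∀ n < 64, (((tabs 11).getD n 0 : ℤ) : ℂ) = cuspCoeff (U3 (S 0)) n :=
  table_heckeT Nat.prime_three 64 (S 0) (stabs 0) (tabs 11) (fun m hm ↦ hs 0 m (by omega)) hder11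
/-- Certified table of basis form `12` = `U₃ h2`. [folklore] -/
theorem hb12 : ∀ n < 64, (((tabs 12).getD n 0 : ℤ) : ℂ) = cuspCoeff (U3 (S 2)) n :=
  table_heckeT Nat.prime_three 64 (S 2) (stabs 2) (tabs 12) (fun m hm ↦ hs 2 m (by omega)) hder12
/-- Certified table of basis form `13` = `χ·U₃ h0`. [folklore] -/
theorem hb13 : ∀ n < 64, (((tabs 13).getD n 0 : ℤ) : ℂ) = cuspCoeff (X (U3 (S 0))) n :=
  table_twist3 (by norm_num : 3 ^ 2 ∣ 171) 64 (U3 (S 0)) (tabs 11) (tabs 13) (hb11 S hs) hder13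
/-- Certified table of basis form `14` = `χ·U₃ h2`. [folklore] -/
theorem hb14 : ∀ n < 64, (((tabs 14).getD n 0 : ℤ) : ℂ) = cuspCoeff (X (U3 (S 2))) n :=
  table_twist3 (by norm_num : 3 ^ 2 ∣ 171) 64 (U3 (S 2)) (tabs 12) (tabs 14) (hb12 S hs) hder14
/-- Certified table of basis form `15` = `χ·χ·U₃ h0`. [folklore] -/
theorem hb15 : ∀ n < 64, (((tabs 15).getD n 0 : ℤ) : ℂ) = cuspCoeff (X (X (U3 (S 0)))) n :=
  table_twist3 (by norm_num : 3 ^ 2 ∣ 171) 64 (X (U3 (S 0))) (tabs 13) (tabs 15) (hb13 S hs) hder15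
/-- Certified table of basis form `16` = `χ·χ·U₃ h2`. [folklore] -/
theorem hb16 : ∀ n < 64, (((tabs 16).getD n 0 : ℤ) : ℂ) = cuspCoeff (X (X (U3 (S 2)))) n :=
  table_twist3 (by norm_num : 3 ^ 2 ∣ 171) 64 (X (U3 (S 2))) (tabs 14) (tabs 16) (hb14 S hs) hder16

/-- **The certified tables of the basis** in the coefficient functionals of `S₂(Γ₀(171))`. [folklore] -/
theorem htabs : ∀ j : Fin 17, ∀ n < 64,
    (((tabs j).getD n 0 : ℤ) : ℂ) = cuspCoeffₗ (one_mem_strictPeriods_coe_gamma0 171) n (basis S j) := by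
  intro j; fin_cases j <;> intro n hn <;> rw [cuspCoeffₗ_apply]
  exacts [hb0 S hs n hn, hb1 S hs n hn, hb2 S hs n hn, hb3 S hs n hn, hb4 S hs n hn, hb5 S hs n hn, hb6 S hs n hn, hb7 S hs n hn, hb8 S hs n hn, hb9 S hs n hn, hb10 S hs n hn, hb11 S hs n hn, hb12 S hs n hn, hb13 S hs n hn, hb14 S hs n hn, hb15 S hs n hn, hb16 S hs n hn]

end Tables

/-! ## §6 The pinning (8 certificates; kernel in `S₂(Γ₀(171))`) -/

/-- **LEVEL 171 PINNED IN `S₂(Γ₀(171))`.**  For every `X₀(171)`-datum `D` of an elliptic `W/ℚ`: with the seed cusp forms `S` (the 3 cuspidal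
`η`-quotients of `Ls`) and the basis `basis S` (their closure under `(·/3)`-twist, `T₂`, `U₃`), for some certificate `c = (σ, d', y) ∈ certs`
the sieve truth of `W` over `3, 2, 5, 7, 11, 13` is `σ` and `d' • D.f = Σ_j y_j • basis S j` (all `d' = 1`: `D.f` is an INTEGER combination).
[cite: CremonaAlgorithms1997, §2.10, Table 1 (171a, 171b, 171c, 171d)] [cite: AtkinLehner1970, Thm. 3] -/
theorem pinning_cusp {W : WeierstrassCurve ℚ} [W.IsElliptic] (D : ModularParametrizationData W 171) :
    ∃ S : Fin 3 → CuspForm (Gamma0 171) 2, (∀ i, ∀ τ : ℍ, S i τ = etaQuotient 171 (expFn (Ls[(i : ℕ)]).1) τ) ∧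
      ∃ c ∈ certs, truth W (stages.map Prod.fst) = c.1 ∧
        ((c.2.1 : ℤ) : ℂ) • D.f = ∑ j : Fin 17, ((c.2.2.getD (j : ℕ) 0 : ℤ) : ℂ) • basis S j := by
  have hlen : ∀ i : Fin 17, (duals i).length ≤ 64 := by
    decide +kernel
  have hrel : ∀ st ∈ stages, ∀ v ∈ st.2, v.length ≤ 64 ∧ ∀ j : Fin 17, dotList v (tabs j) = 0 := by
    decide +kernel
  have hps : ∀ st ∈ stages, st.1.Prime := by
    intro st hst
    have h : st.1 ∈ stages.map Prod.fst := List.mem_map.mpr ⟨st, hst, rfl⟩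
    have hl : stages.map Prod.fst = [3, 2, 5, 7, 11, 13] := by decide
    rw [hl] at h
    simp only [List.mem_cons, List.mem_nil_iff, or_false] at h
    rcases h with h | h | h | h | h | h <;> rw [h] <;> norm_num
  obtain ⟨S, hS⟩ := exists_etaCuspForms 171 Ls hcusp
  obtain ⟨C, hCS⟩ : ∃ C : Fin 3 → ModularForm (Gamma0 171) 2, ∀ i, ModularFormClass.modularForm (S i) = C i :=
    ⟨_, fun _ ↦ rfl⟩
  have hC : ∀ i, ∀ τ : ℍ, C i τ = etaQuotient 171 (expFn (Ls[(i : ℕ)]).1) τ := fun i τ ↦ by rw [← hCS]; exact hS i τ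
  have ht := tables_of_etaCertsSparse 171 192 (fun i : Fin 3 ↦ expFn (Ls[(i : ℕ)]).1) (fun i ↦ shifts i) stabs C hC hshift hcert
  have hs : ∀ i, ∀ m < 192, (((stabs i).getD m 0 : ℤ) : ℂ) = cuspCoeff (S i) m :=
    fun i m hm ↦ by rw [← modCoefₗ_modularForm (S i) m, hCS]; exact ht i m hm
  haveI : FiniteDimensional ℂ (CuspForm (Gamma0 171) 2) := finiteDimensional_cuspForm_gamma0 171 2
  have hF : ∀ n, cuspCoeffₗ (one_mem_strictPeriods_coe_gamma0 171) n D.f = ((W.LFunction n : ℤ) : ℂ) :=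
    fun n ↦ by rw [cuspCoeffₗ_apply]; exact D.isNewformOf.2 n
  obtain ⟨c, hc, hc1, hpin⟩ := exists_smul_eq_sum_of_certs D D.f hF (basis S) tabs duals 2160 (htabs S hs) hlen hdual
    (by norm_num) finrank_cuspForm_two stages hps hrel certs hcover hpiv
  exact ⟨S, hS, c, hc, hc1.symm, hpin⟩

end Summit.BirchSwinnertonDyer.BirchSwinnertonDyer.Theorems.ManinLocalTwoThree.PinningOneSeventyOne

end
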